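import Summits.ABC.ABC.Theses.IneffectiveSubspace
import Literature.NumberTheory.DiophantineGeometry.AbcWave0BakerExplicitProofs
import Literature.NumberTheory.DiophantineGeometry.PastenSubexpTheorem14

/-!
# `DeepRegimeABC` (stmt-ABC-15121): the `ω`-normal form, the complement theorem, and the target shape

Support lemmas (line `Sketch`, card `omega-collapse`) for the crux
`Summit.ABC.ABC.Theses.IneffectiveSubspace.DeepRegimeABC` — abc on the `ε`-dependent deep tail
`{ω₅(abc) ≥ K(ε)}`, `ω₅(n) := #{p : p⁵ ∣ n}` — over existing declarations only (no new definition; the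
tail statements are written out):
* quintic breeding `(c⁵ − b⁵) + b⁵ = c⁵` (`isABCTriple_quinticBreed`, `rad_quinticBreed_le`:
  `rad ≤ rad(abc)·5c⁴`, `card_primeFactors_le_depth_quinticBreed`: every prime of `bc` becomes 5-deep,
  `lt_of_quinticBreed_bound`: the real-exponent bookkeeping);
* the normal form `deepRegimeABC_iff_omegaTail`: the crux ⟺ abc on the `ε`-dependent MANY-PRIMES tail
  `{ω(abc) ≥ W(ε)}` (the depth `5` is decorative; `η := ε/(5+4ε)`, `W := 2K(η)`);
* `deepRegimeABC_of_abc` (`K := 0`), `abc_of_depthCountedABC_of_deepRegimeABC` (the route's case split),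
  `abc_iff_deepRegimeABC_and_boundedOmega` (`ABC ⟺ crux ∧ abc on every bounded-ω cell`);
* the target shape `deepRegimeABC_of_expOmegaBound`: an abc bound with simply-exponential loss in
  `ω(abc)`, `c < C(ε)·e^{A(ε)·ω(abc)}·rad^(1+ε)`, already implies the crux (`rad(abc) ≥ ω(abc)!` absorbs
  `e^{A·ω}` into `rad^ε` on the tail: `exp_mul_card_primeFactors_le_radical_rpow`).
Sources: breeding/radical accounting is folklore (cf. J. Ellenberg, *Congruence ABC implies ABC*, Indag.
Math. 11 (2000) [Ellenberg2000]); `ω(n)! ≤ rad(n)` is `factorial_cardDistinctFactors_le_radical`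
(A. Baker, Publ. Math. Debrecen 65 (2004) §3 [Baker2004]); `IsABCTriple.swap`, `rad_swap` are reused
from `Literature.NumberTheory.DiophantineGeometry` (PastenSubexpTheorem14).
-/

-- `Summit.<Summit>.<Problem>` is the mandated summit-side namespace (CONVENTIONS §2); for the
-- single-conjunct summit `ABC` the two coincide, so the duplicate `ABC.ABC` is deliberate.
set_option linter.dupNamespace false

namespace Summit.ABC.ABC.Theorems.DeepRegimeABC

open Literature.NumberTheory.DiophantineGeometry UniqueFactorizationMonoid
open Summit.ABC.ABC.Theses.IneffectiveSubspace

/-- `c⁵ − b⁵ = a · Φ₅(c,b)` when `a + b = c`, with `Φ₅(c,b) = c⁴ + c³b + c²b² + cb³ + b⁴`. [folklore] -/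
theorem pow_five_sub_pow_five_eq {a b c : ℕ} (h : a + b = c) :
    c ^ 5 - b ^ 5 = a * (c ^ 4 + c ^ 3 * b + c ^ 2 * b ^ 2 + c * b ^ 3 + b ^ 4) := by
  subst h
  apply Nat.sub_eq_of_eq_add
  ring

/-- `Φ₅(c,b) ≤ 5c⁴` for `b ≤ c`. [folklore] -/
theorem quinticCofactor_le {b c : ℕ} (hbc : b ≤ c) :
    c ^ 4 + c ^ 3 * b + c ^ 2 * b ^ 2 + c * b ^ 3 + b ^ 4 ≤ 5 * c ^ 4 := by
  have h1 : c ^ 3 * b ≤ c ^ 3 * c := Nat.mul_le_mul_left _ hbc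
  have h2 : c ^ 2 * b ^ 2 ≤ c ^ 2 * c ^ 2 := Nat.mul_le_mul_left _ (Nat.pow_le_pow_left hbc 2)
  have h3 : c * b ^ 3 ≤ c * c ^ 3 := Nat.mul_le_mul_left _ (Nat.pow_le_pow_left hbc 3)
  have h4 : b ^ 4 ≤ c ^ 4 := Nat.pow_le_pow_left hbc 4
  have e1 : c ^ 3 * c = c ^ 4 := (by ring); have e2 : c ^ 2 * c ^ 2 = c ^ 4 := by ring
  have e3 : c * c ^ 3 = c ^ 4 := by ring
  omega

/-- `0 < Φ₅(c,b)` for `0 < c`. [folklore] -/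
theorem quinticCofactor_pos {b c : ℕ} (hc : 0 < c) :
    0 < c ^ 4 + c ^ 3 * b + c ^ 2 * b ^ 2 + c * b ^ 3 + b ^ 4 := by
  have : 0 < c ^ 4 := pow_pos hc 4
  omega

/-- Breeding preserves abc triples: `(c⁵ − b⁵) + b⁵ = c⁵` is again an abc triple. [folklore] -/
theorem isABCTriple_quinticBreed {a b c : ℕ} (h : IsABCTriple a b c) :
    IsABCTriple (c ^ 5 - b ^ 5) (b ^ 5) (c ^ 5) := by
  obtain ⟨ha, hb, habc, hcop⟩ := h
  have hbc : b < c := by omega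
  have hpow : b ^ 5 < c ^ 5 := Nat.pow_lt_pow_left hbc (by norm_num)
  have hcb : Nat.Coprime c b := by
    rw [← habc]; exact Nat.coprime_add_self_left.mpr hcop
  refine ⟨Nat.sub_pos_of_lt hpow, pow_pos hb 5, Nat.sub_add_cancel hpow.le, ?_⟩
  exact (Nat.coprime_sub_self_left hpow.le).mpr (Nat.Coprime.pow 5 5 hcb)

/-- A product over a union of finsets of positive naturals is at most the product of the two
products. [folklore] -/
theorem prod_union_le_prod_mul_prod {s t : Finset ℕ} (h : ∀ p ∈ s ∩ t, 0 < p) :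
    (∏ p ∈ s ∪ t, p) ≤ (∏ p ∈ s, p) * ∏ p ∈ t, p := by
  rw [← Finset.prod_union_inter]
  exact Nat.le_mul_of_pos_right _ (Finset.prod_pos h)

/-- **Breeding, radical**: `rad((c⁵−b⁵)·b⁵·c⁵) ≤ rad(abc)·Φ₅(c,b) ≤ rad(abc)·5c⁴`. [folklore] -/
theorem rad_quinticBreed_le {a b c : ℕ} (h : IsABCTriple a b c) :
    rad (c ^ 5 - b ^ 5) (b ^ 5) (c ^ 5) ≤ rad a b c * (5 * c ^ 4) := by
  obtain ⟨ha, hb, habc, hcop⟩ := h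
  have hc : 0 < c := (by omega); have hbc : b ≤ c := by omega
  set Φ : ℕ := c ^ 4 + c ^ 3 * b + c ^ 2 * b ^ 2 + c * b ^ 3 + b ^ 4 with hΦdef
  have hΦ : 0 < Φ := quinticCofactor_pos hc
  have hx : c ^ 5 - b ^ 5 = a * Φ := pow_five_sub_pow_five_eq habc
  rw [rad_def, rad_def, hx, Nat.radical_eq_prod_primeFactors, Nat.radical_eq_prod_primeFactors]
  have ha0 : a ≠ 0 := ha.ne'; have hb0 : b ≠ 0 := hb.ne'; have hc0 : c ≠ 0 := hc.ne'
  have hΦ0 : Φ ≠ 0 := hΦ.ne'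
  have hkey : (a * Φ * b ^ 5 * c ^ 5).primeFactors = (a * b * c).primeFactors ∪ Φ.primeFactors := by
    rw [Nat.primeFactors_mul (by positivity) (by positivity),
      Nat.primeFactors_mul (by positivity) (by positivity),
      Nat.primeFactors_mul ha0 hΦ0, Nat.primeFactors_pow _ (by norm_num), Nat.primeFactors_pow _
        (by norm_num), Nat.primeFactors_mul (by positivity) hc0, Nat.primeFactors_mul ha0 hb0]
    ext p
    simp only [Finset.mem_union]
    tauto
  rw [hkey]
  calc (∏ p ∈ (a * b * c).primeFactors ∪ Φ.primeFactors, p)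
      ≤ (∏ p ∈ (a * b * c).primeFactors, p) * ∏ p ∈ Φ.primeFactors, p :=
        prod_union_le_prod_mul_prod
          (fun p hp => (Nat.prime_of_mem_primeFactors (Finset.mem_inter.mp hp).1).pos)
    _ ≤ (∏ p ∈ (a * b * c).primeFactors, p) * (5 * c ^ 4) := by
        apply Nat.mul_le_mul_left
        calc (∏ p ∈ Φ.primeFactors, p) = radical Φ := (Nat.radical_eq_prod_primeFactors).symm
          _ ≤ Φ := Nat.radical_le_self_iff.mpr hΦ0
          _ ≤ 5 * c ^ 4 := quinticCofactor_le hbc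

/-- **Breeding, depth**: every prime of `bc` is 5-deep in the bred triple, so
`ω(b) + ω(c) ≤ ω₅((c⁵−b⁵)·b⁵·c⁵)`. [folklore] -/
theorem card_primeFactors_le_depth_quinticBreed {a b c : ℕ} (h : IsABCTriple a b c) :
    b.primeFactors.card + c.primeFactors.card ≤
      (((c ^ 5 - b ^ 5) * b ^ 5 * c ^ 5).primeFactors.filter
        (fun p => 5 ≤ ((c ^ 5 - b ^ 5) * b ^ 5 * c ^ 5).factorization p)).card := by
  obtain ⟨ha, hb, habc, hcop⟩ := h
  have hc : 0 < c := by omega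
  have hx : c ^ 5 - b ^ 5 = a * (c ^ 4 + c ^ 3 * b + c ^ 2 * b ^ 2 + c * b ^ 3 + b ^ 4) :=
    pow_five_sub_pow_five_eq habc
  have hΦ0 : c ^ 4 + c ^ 3 * b + c ^ 2 * b ^ 2 + c * b ^ 3 + b ^ 4 ≠ 0 := (quinticCofactor_pos hc).ne'
  have ha0 : a ≠ 0 := ha.ne'; have hb0 : b ≠ 0 := hb.ne'; have hc0 : c ≠ 0 := hc.ne'
  have hx0 : c ^ 5 - b ^ 5 ≠ 0 := by rw [hx]; positivity
  have hcb : Nat.Coprime c b := by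
    rw [← habc]; exact Nat.coprime_add_self_left.mpr hcop
  set P : ℕ := (c ^ 5 - b ^ 5) * b ^ 5 * c ^ 5 with hP
  have hP0 : P ≠ 0 := by positivity
  have hfac : P.factorization =
      (c ^ 5 - b ^ 5).factorization + 5 • b.factorization + 5 • c.factorization := by
    rw [hP, Nat.factorization_mul (by positivity) (by positivity),
      Nat.factorization_mul hx0 (by positivity), Nat.factorization_pow, Nat.factorization_pow]
  rw [← Finset.card_union_of_disjoint (Nat.Coprime.disjoint_primeFactors hcb.symm)]
  apply Finset.card_le_card
  intro p hp
  rw [Finset.mem_filter]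
  have hp' : p.Prime ∧ (p ∣ b ∨ p ∣ c) := by
    rcases Finset.mem_union.mp hp with h | h
    · exact ⟨Nat.prime_of_mem_primeFactors h, Or.inl (Nat.dvd_of_mem_primeFactors h)⟩
    · exact ⟨Nat.prime_of_mem_primeFactors h, Or.inr (Nat.dvd_of_mem_primeFactors h)⟩
  obtain ⟨hpp, hdvd⟩ := hp'
  constructor
  · rw [Nat.mem_primeFactors]
    refine ⟨hpp, ?_, hP0⟩
    rcases hdvd with h | h
    · exact Dvd.dvd.mul_right (Dvd.dvd.mul_left (dvd_pow h (by norm_num)) _) _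
    · exact Dvd.dvd.mul_left (dvd_pow h (by norm_num)) _
  · show 5 ≤ P.factorization p
    rw [hfac]
    simp only [Finsupp.add_apply, Finsupp.smul_apply, smul_eq_mul]
    rcases hdvd with h | h
    · have : 1 ≤ b.factorization p := hpp.factorization_pos_of_dvd hb0 h
      omega
    · have : 1 ≤ c.factorization p := hpp.factorization_pos_of_dvd hc0 h
      omega

/-- `ω(abc) ≤ ω(a) + ω(b) + ω(c)`. [folklore] -/
theorem card_primeFactors_mul_three_le {a b c : ℕ} (ha : a ≠ 0) (hb : b ≠ 0) (hc : c ≠ 0) :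
    (a * b * c).primeFactors.card ≤
      a.primeFactors.card + b.primeFactors.card + c.primeFactors.card := by
  rw [Nat.primeFactors_mul (by positivity) hc, Nat.primeFactors_mul ha hb]
  exact (Finset.card_union_le _ _).trans (Nat.add_le_add_right (Finset.card_union_le _ _) _)

/-- **Real-exponent bookkeeping of one breeding step**: from `c⁵ < C·(R·5c⁴)^(1+η)` with
`0 < 1 − 4η` deduce `c < (C·5^(1+η))^(1/(1−4η)) · R^((1+η)/(1−4η))`. [folklore] -/
theorem lt_of_quinticBreed_bound {C R c η : ℝ} (hC : 0 < C) (hR : 1 ≤ R) (hc : 1 ≤ c) (hη : 0 < η)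
    (hη4 : 4 * η < 1)
    (h : c ^ (5 : ℕ) < C * (R * (5 * c ^ (4 : ℕ))) ^ (1 + η)) :
    c < (C * 5 ^ (1 + η)) ^ (1 / (1 - 4 * η)) * R ^ ((1 + η) * (1 / (1 - 4 * η))) := by
  have hc0 : 0 < c := (by linarith); have hR0 : 0 < R := by linarith
  have ht : 0 < 1 - 4 * η := by linarith
  have ht' : 0 < 1 / (1 - 4 * η) := by positivity
  have hexp : (R * (5 * c ^ (4 : ℕ))) ^ (1 + η) = R ^ (1 + η) * 5 ^ (1 + η) * c ^ (4 * (1 + η)) := by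
    rw [Real.mul_rpow hR0.le (by positivity), Real.mul_rpow (by norm_num) (by positivity)]
    rw [show (c ^ (4 : ℕ) : ℝ) = c ^ (4 : ℝ) by norm_cast, ← Real.rpow_mul hc0.le]
    ring
  rw [hexp] at h
  have hc5 : c ^ (5 : ℕ) = c ^ (5 : ℝ) := by norm_cast
  rw [hc5] at h
  have hcpow : 0 < c ^ (4 * (1 + η)) := Real.rpow_pos_of_pos hc0 _
  have h2 : c ^ (5 : ℝ) / c ^ (4 * (1 + η)) < C * 5 ^ (1 + η) * R ^ (1 + η) := by
    rw [div_lt_iff₀ hcpow]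
    calc c ^ (5 : ℝ) < C * (R ^ (1 + η) * 5 ^ (1 + η) * c ^ (4 * (1 + η))) := h
      _ = C * 5 ^ (1 + η) * R ^ (1 + η) * c ^ (4 * (1 + η)) := by ring
  rw [← Real.rpow_sub hc0] at h2
  have hsub : (5 : ℝ) - 4 * (1 + η) = 1 - 4 * η := by ring
  rw [hsub] at h2
  have hlhs : 0 ≤ c ^ (1 - 4 * η) := (Real.rpow_pos_of_pos hc0 _).le
  have h3 := Real.rpow_lt_rpow hlhs h2 ht'
  rw [← Real.rpow_mul hc0.le, show (1 - 4 * η) * (1 / (1 - 4 * η)) = 1 by field_simp,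
    Real.rpow_one] at h3
  calc c < (C * 5 ^ (1 + η) * R ^ (1 + η)) ^ (1 / (1 - 4 * η)) := h3
    _ = (C * 5 ^ (1 + η)) ^ (1 / (1 - 4 * η)) * R ^ ((1 + η) * (1 / (1 - 4 * η))) := by
        rw [Real.mul_rpow (by positivity) (by positivity), Real.rpow_mul hR0.le]

/-- **Breeding direction of the normal form.** The deep tail implies the many-primes tail:
if abc holds on `{ω₅(abc) ≥ K(η)}` for every `η > 0`, then for every `ε > 0` abc holds on
`{ω(abc) ≥ 2K(η)}` with `η = ε/(5+4ε)` — breed `(c⁵−b⁵) + b⁵ = c⁵` on the prime-richer of `{a, b}`.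
[folklore] -/
theorem omegaTail_of_deepRegimeABC : Summit.ABC.ABC.Theses.IneffectiveSubspace.DeepRegimeABC →
    ∀ ε : ℝ, 0 < ε → ∃ W : ℕ, ∃ C : ℝ, 0 < C ∧ ∀ a b c : ℕ,
      Literature.NumberTheory.DiophantineGeometry.IsABCTriple a b c →
      W ≤ (a * b * c).primeFactors.card →
      (c : ℝ) < C * ((Literature.NumberTheory.DiophantineGeometry.rad a b c : ℕ) : ℝ) ^ (1 + ε) := by
  intro h ε hε
  set η : ℝ := ε / (5 + 4 * ε) with hηdef
  have h54 : (0 : ℝ) < 5 + 4 * ε := by linarith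
  have hη : 0 < η := by positivity
  have hη4 : 4 * η < 1 := by
    rw [hηdef, ← lt_div_iff₀' (by norm_num : (0:ℝ) < 4), div_lt_div_iff₀ h54 (by norm_num)]
    linarith
  have hexp1 : (1 + η) * (1 / (1 - 4 * η)) = 1 + ε := by
    rw [hηdef]
    field_simp
    ring
  obtain ⟨K, C, hC, hK⟩ := h η hη
  set C' : ℝ := (C * 5 ^ (1 + η)) ^ (1 / (1 - 4 * η)) with hC'def
  have hC' : 0 < C' := Real.rpow_pos_of_pos (by positivity) _
  -- core step: breed on the pair (b, c)
  have core : ∀ a b c : ℕ, IsABCTriple a b c → K ≤ b.primeFactors.card + c.primeFactors.card →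
      (c : ℝ) < C' * ((rad a b c : ℕ) : ℝ) ^ (1 + ε) := by
    intro a b c habc hKbc
    have habc' := isABCTriple_quinticBreed habc
    have hdeep := hKbc.trans (card_primeFactors_le_depth_quinticBreed habc)
    have hlt := hK _ _ _ habc' hdeep
    obtain ⟨ha, hb, hsum, hcop⟩ := habc
    have hc1 : (1 : ℝ) ≤ c := by exact_mod_cast (show 1 ≤ c by omega)
    have hrad_pos : 0 < rad a b c := by
      rw [rad_def]
      exact Nat.pos_of_ne_zero radical_ne_zero
    have hR1 : (1 : ℝ) ≤ (rad a b c : ℕ) := by exact_mod_cast hrad_pos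
    have hradle : ((rad (c ^ 5 - b ^ 5) (b ^ 5) (c ^ 5) : ℕ) : ℝ) ≤
        (rad a b c : ℕ) * (5 * (c : ℝ) ^ (4 : ℕ)) := by
      exact_mod_cast rad_quinticBreed_le ⟨ha, hb, hsum, hcop⟩
    have h1η : 0 ≤ 1 + η := by linarith
    have hstep : (c : ℝ) ^ (5 : ℕ) <
        C * (((rad a b c : ℕ) : ℝ) * (5 * (c : ℝ) ^ (4 : ℕ))) ^ (1 + η) := by
      have hcast : ((c ^ 5 : ℕ) : ℝ) = (c : ℝ) ^ (5 : ℕ) := by push_cast; ring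
      rw [← hcast]
      refine hlt.trans_le ?_
      apply mul_le_mul_of_nonneg_left _ hC.le
      exact Real.rpow_le_rpow (Nat.cast_nonneg _) hradle h1η
    have := lt_of_quinticBreed_bound hC hR1 hc1 hη hη4 hstep
    rwa [hexp1] at this
  refine ⟨2 * K, C', hC', fun a b c habc hW => ?_⟩
  obtain ⟨ha, hb, hsum, hcop⟩ := habc
  have hω := card_primeFactors_mul_three_le ha.ne' hb.ne' (show c ≠ 0 by omega)
  by_cases hcase : a.primeFactors.card ≤ b.primeFactors.card
  · exact core a b c ⟨ha, hb, hsum, hcop⟩ (by omega)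
  · have := core b a c (IsABCTriple.swap ⟨ha, hb, hsum, hcop⟩) (by omega)
    rwa [rad_swap] at this

/-- **Trivial direction of the normal form**: the many-primes tail contains the deep tail
(`ω₅(abc) ≤ ω(abc)`). [folklore] -/
theorem deepRegimeABC_of_omegaTail
    (h : ∀ ε : ℝ, 0 < ε → ∃ W : ℕ, ∃ C : ℝ, 0 < C ∧ ∀ a b c : ℕ, IsABCTriple a b c →
      W ≤ (a * b * c).primeFactors.card → (c : ℝ) < C * ((rad a b c : ℕ) : ℝ) ^ (1 + ε)) :
    DeepRegimeABC := by
  intro ε hε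
  obtain ⟨W, C, hC, hW⟩ := h ε hε
  exact ⟨W, C, hC, fun a b c habc hK => hW a b c habc (hK.trans (Finset.card_filter_le _ _))⟩

/-- **`ω`-normal form of the crux** (card `omega-collapse`; also found independently as
`omega-tail-normal-form`): `DeepRegimeABC` is EQUIVALENT to abc on the `ε`-dependent many-primes tail
`{ω(abc) ≥ W(ε)}` — the depth `5` in the crux is decorative. [folklore] -/
theorem deepRegimeABC_iff_omegaTail :
    DeepRegimeABC ↔
      ∀ ε : ℝ, 0 < ε → ∃ W : ℕ, ∃ C : ℝ, 0 < C ∧ ∀ a b c : ℕ, IsABCTriple a b c →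
        W ≤ (a * b * c).primeFactors.card → (c : ℝ) < C * ((rad a b c : ℕ) : ℝ) ^ (1 + ε) :=
  ⟨omegaTail_of_deepRegimeABC, deepRegimeABC_of_omegaTail⟩

/-- **Upper half of the sandwich**: `ABC → DeepRegimeABC` (`K := 0`). [folklore] -/
theorem deepRegimeABC_of_abc (h : _root_.ABC) : DeepRegimeABC := by
  intro ε hε
  obtain ⟨C, hC, hC'⟩ := (ABC_iff.mp h) ε hε
  exact ⟨0, C, hC, fun a b c habc _ => hC' a b c habc⟩

/-- **The route's case split, importable**: abc with a constant per depth cell (`DepthCountedABC`,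
crux #5) and abc on the `ε`-dependent deep tail (`DeepRegimeABC`, crux #6) give `ABC` — split at the
single cell `K(ε)` and take the larger constant. [folklore] -/
theorem abc_of_depthCountedABC_of_deepRegimeABC (h₅ : DepthCountedABC) (h₆ : DeepRegimeABC) :
    _root_.ABC := by
  rw [ABC_iff]
  intro ε hε
  obtain ⟨K, C₁, hC₁, h₁⟩ := h₆ ε hε
  obtain ⟨C₂, _hC₂, h₂⟩ := h₅ K ε hε
  refine ⟨max C₁ C₂, lt_max_of_lt_left hC₁, fun a b c habc => ?_⟩
  have hr : (0 : ℝ) ≤ ((rad a b c : ℕ) : ℝ) ^ (1 + ε) := Real.rpow_nonneg (Nat.cast_nonneg _) _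
  by_cases hK : K ≤ ((a * b * c).primeFactors.filter (fun p => 5 ≤ (a * b * c).factorization p)).card
  · exact (h₁ a b c habc hK).trans_le (mul_le_mul_of_nonneg_right (le_max_left _ _) hr)
  · exact (h₂ a b c habc (not_le.mp hK).le).trans_le (mul_le_mul_of_nonneg_right (le_max_right _ _) hr)

/-- **Complement theorem**: the crux together with abc on every BOUNDED-`ω` cell (constant allowed to
depend on the cell — the S-unit / Pillai corner with moving primes) gives `ABC`: case split at the single
cell `W(ε)` of the `ω`-normal form. [folklore] -/
theorem abc_of_deepRegimeABC_of_boundedOmega (h₆ : DeepRegimeABC)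
    (hcorner : ∀ W : ℕ, ∀ ε : ℝ, 0 < ε → ∃ C : ℝ, 0 < C ∧ ∀ a b c : ℕ, IsABCTriple a b c →
      (a * b * c).primeFactors.card ≤ W → (c : ℝ) < C * ((rad a b c : ℕ) : ℝ) ^ (1 + ε)) :
    _root_.ABC := by
  rw [ABC_iff]
  intro ε hε
  obtain ⟨W, C₁, hC₁, hW⟩ := omegaTail_of_deepRegimeABC h₆ ε hε
  obtain ⟨C₂, _hC₂, hW'⟩ := hcorner W ε hε
  refine ⟨max C₁ C₂, lt_max_of_lt_left hC₁, fun a b c habc => ?_⟩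
  have hr : (0 : ℝ) ≤ ((rad a b c : ℕ) : ℝ) ^ (1 + ε) := Real.rpow_nonneg (Nat.cast_nonneg _) _
  by_cases hK : W ≤ (a * b * c).primeFactors.card
  · exact (hW a b c habc hK).trans_le (mul_le_mul_of_nonneg_right (le_max_left _ _) hr)
  · exact (hW' a b c habc (not_le.mp hK).le).trans_le
      (mul_le_mul_of_nonneg_right (le_max_right _ _) hr)

/-- **`ABC ⟺ DeepRegimeABC ∧ BoundedOmegaABC`**: the crux is exactly "abc off the bounded-`ω` corner".
[folklore] -/
theorem abc_iff_deepRegimeABC_and_boundedOmega :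
    _root_.ABC ↔ DeepRegimeABC ∧
      ∀ W : ℕ, ∀ ε : ℝ, 0 < ε → ∃ C : ℝ, 0 < C ∧ ∀ a b c : ℕ, IsABCTriple a b c →
        (a * b * c).primeFactors.card ≤ W → (c : ℝ) < C * ((rad a b c : ℕ) : ℝ) ^ (1 + ε) := by
  refine ⟨fun h => ⟨deepRegimeABC_of_abc h, fun W ε hε => ?_⟩,
    fun h => abc_of_deepRegimeABC_of_boundedOmega h.1 h.2⟩
  obtain ⟨C, hC, hC'⟩ := (ABC_iff.mp h) ε hε
  exact ⟨C, hC, fun a b c habc _ => hC' a b c habc⟩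

/-- **Absorption on the tail.** For `A ≥ 0` and `ε > 0` there is `W` such that every `n` with
`ω(n) ≥ W` satisfies `e^{A·ω(n)} ≤ rad(n)^ε`: indeed `rad(n) ≥ ω(n)! ≥ (M+1)^(ω(n)−M)` for every
`M ≤ ω(n)`; take `log(M+1) ≥ 2A/ε` and `W = 2M`. [folklore] -/
theorem exp_mul_card_primeFactors_le_radical_rpow {A ε : ℝ} (hA : 0 ≤ A) (hε : 0 < ε) :
    ∃ W : ℕ, ∀ n : ℕ, W ≤ n.primeFactors.card →
      Real.exp (A * n.primeFactors.card) ≤ ((radical n : ℕ) : ℝ) ^ ε := by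
  set M : ℕ := ⌈Real.exp (2 * A / ε)⌉₊ with hMdef
  have hM : 2 * A / ε ≤ Real.log ((M : ℝ) + 1) := by
    have h1 : Real.exp (2 * A / ε) ≤ (M : ℝ) + 1 := (Nat.le_ceil _).trans (by linarith)
    calc 2 * A / ε = Real.log (Real.exp (2 * A / ε)) := (Real.log_exp _).symm
      _ ≤ Real.log ((M : ℝ) + 1) := Real.log_le_log (Real.exp_pos _) h1
  refine ⟨2 * M, fun n hn => ?_⟩
  set k : ℕ := n.primeFactors.card with hkdef
  -- `(M+1)^(k-M) ≤ k! ≤ rad n`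
  have hfac : k.factorial ≤ radical n := by
    have := factorial_cardDistinctFactors_le_radical n
    rwa [cardDistinctFactors_eq_card_primeFactors] at this
  have hpow : (M + 1) ^ (k - M) ≤ k.factorial := by
    have h1 := @Nat.factorial_mul_pow_le_factorial M (k - M)
    have hkM : M + (k - M) = k := by omega
    rw [hkM] at h1
    exact le_trans (Nat.le_mul_of_pos_left _ (Nat.factorial_pos M)) h1
  have hR : ((M : ℝ) + 1) ^ (k - M) ≤ ((radical n : ℕ) : ℝ) := by
    exact_mod_cast hpow.trans hfac
  have hM1 : (0 : ℝ) < (M : ℝ) + 1 := by positivity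
  have hkM : (k : ℝ) ≤ 2 * ((k - M : ℕ) : ℝ) := by
    have : k ≤ 2 * (k - M) := by omega
    exact_mod_cast this
  have hlog0 : 0 ≤ Real.log ((M : ℝ) + 1) := Real.log_nonneg (by linarith)
  calc Real.exp (A * k)
      ≤ Real.exp (ε * (((k - M : ℕ) : ℝ) * Real.log ((M : ℝ) + 1))) := by
        apply Real.exp_le_exp.mpr
        calc A * k ≤ A * (2 * ((k - M : ℕ) : ℝ)) := by gcongr
          _ = (2 * A / ε) * ((k - M : ℕ) : ℝ) * ε := by field_simp
          _ ≤ Real.log ((M : ℝ) + 1) * ((k - M : ℕ) : ℝ) * ε := by gcongr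
          _ = ε * (((k - M : ℕ) : ℝ) * Real.log ((M : ℝ) + 1)) := by ring
    _ = (((M : ℝ) + 1) ^ (k - M)) ^ ε := by
        rw [Real.rpow_def_of_pos (pow_pos hM1 _), Real.log_pow]
        ring_nf
    _ ≤ ((radical n : ℕ) : ℝ) ^ ε := Real.rpow_le_rpow (by positivity) hR hε.le

/-- **Target shape (absorption theorem).** Any abc bound with a SIMPLY-EXPONENTIAL loss in the number
of primes — for every `ε > 0` constants `A`, `C` with `c < C·e^{A·ω(abc)}·rad(abc)^(1+ε)` for all abc
triples — already implies the crux `DeepRegimeABC`: on the tail `{ω(abc) ≥ W}` the factor `e^{A·ω}` is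
absorbed by `rad^(ε)` since `rad(abc) ≥ ω(abc)!`.  (So e.g. Baker's 1998 `ε^{-ω}` conjecture would
suffice; no such bound is a theorem — the printed dependence on `ω` of every proved bound is far worse.)
[folklore] -/
theorem deepRegimeABC_of_expOmegaBound
    (h : ∀ ε : ℝ, 0 < ε → ∃ A C : ℝ, 0 < C ∧ ∀ a b c : ℕ, IsABCTriple a b c →
      (c : ℝ) < C * Real.exp (A * (a * b * c).primeFactors.card) *
        ((rad a b c : ℕ) : ℝ) ^ (1 + ε)) :
    DeepRegimeABC := by
  apply deepRegimeABC_of_omegaTail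
  intro ε hε
  obtain ⟨A, C, hC, hAC⟩ := h (ε / 2) (half_pos hε)
  obtain ⟨W, hW⟩ := exp_mul_card_primeFactors_le_radical_rpow (le_max_right A 0) (half_pos hε)
  refine ⟨W, C, hC, fun a b c habc hWle => ?_⟩
  have h1 := hAC a b c habc
  have hradR : ((rad a b c : ℕ) : ℝ) = ((radical (a * b * c) : ℕ) : ℝ) := by rw [rad_def]
  have hrad_pos : (0 : ℝ) < ((rad a b c : ℕ) : ℝ) := by
    rw [hradR]; exact_mod_cast Nat.pos_of_ne_zero radical_ne_zero
  have h2 : Real.exp (A * (a * b * c).primeFactors.card) ≤ ((rad a b c : ℕ) : ℝ) ^ (ε / 2) := by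
    rw [hradR]
    refine le_trans (Real.exp_le_exp.mpr ?_) (hW (a * b * c) hWle)
    exact mul_le_mul_of_nonneg_right (le_max_left A 0) (Nat.cast_nonneg _)
  have h3 : (0 : ℝ) ≤ ((rad a b c : ℕ) : ℝ) ^ (1 + ε / 2) := Real.rpow_nonneg hrad_pos.le _
  calc (c : ℝ) < C * Real.exp (A * (a * b * c).primeFactors.card) *
        ((rad a b c : ℕ) : ℝ) ^ (1 + ε / 2) := h1
    _ ≤ C * ((rad a b c : ℕ) : ℝ) ^ (ε / 2) * ((rad a b c : ℕ) : ℝ) ^ (1 + ε / 2) := by gcongr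
    _ = C * ((rad a b c : ℕ) : ℝ) ^ (1 + ε) := by
        rw [mul_assoc, ← Real.rpow_add hrad_pos]
        ring_nf

end Summit.ABC.ABC.Theorems.DeepRegimeABC
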